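import Summits.QuantumFields.YangMills.Theorems.BalabanUVNodesN15KingModelMasslessReflectionPositivity
import Summits.QuantumFields.YangMills.Theorems.BalabanUVNodesN15KingModelReflectionPositivityCharFun
import Summits.QuantumFields.YangMills.Theorems.BalabanUVNodesN15KingModelSubGaussianTails

/-!
# BalabanUVNodes ∕ N15 — THE KING-MODEL RUNG (PART Ϻ-ff): THE MASSLESS FIELD AS THE WEAK (LÉVY) LIMIT `μ_{∞,m} ⇒ μ⁰_∞` AND ITS SUB-GAUSSIAN TAILS — characteristic functionals
# `E_m[e^{iφ(f)}] = e^{−V^m_f∕2} → e^{−V⁰_f∕2} = E_0[e^{iφ(f)}]` as `m ↓ 0` (all finite-dimensional marginals converge weakly), Chernoff tails `μ⁰_∞{|φ(z)| ≥ a} ≤ 2e^{−a²∕2S₂^{0}(0)}`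
# (`≤ 2e^{−a²∕6}`), and almost-sure logarithmic growth of the massless block field (`d + 1 ≥ 3`; Track A, DAG node N15 = NE2; FAN-OUT v1.1 §N15 s3 «KING-MODEL RUNG»; count-neutral)

HONEST FRAMING.  Count-neutral (cell `pub-ymgap`, seat `pub-ymgap-dag-n15-e` g35; `--supports stmt-QuantumFields-27366 --as helper` = K3⁸).  King's `A = 0`, `g = 0` model
([King1986] C. King, Commun. Math. Phys. **102** (1986) 649–677).  Part Ϻ-x gave convergence of all MOMENTS `μ_{∞,m} → μ⁰_∞`; here the same in LÉVY form: ★★ the characteristic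
functional of every field sum converges, `∫e^{iΣc_jφ(z_j)}dμ_{∞,m} → ∫e^{iΣc_jφ(z_j)}dμ⁰_∞` as `m² ↓ 0` (Gaussian characteristic functions + part Ϻ-x's `S₂^{ℝ}_m → S₂^{0}`), i.e. every
finite-dimensional marginal of `μ_{∞,m}` converges weakly to that of `μ⁰_∞`.  And part Ϻ-w at zero mass: ★★ `μ⁰_∞{a ≤ Σc_jφ(z_j)} ≤ e^{−a²∕2V⁰}`, `μ⁰_∞{|φ(z)| ≥ a} ≤ 2e^{−a²∕2S₂^{0}(0)} ≤ 2e^{−a²∕6}`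
(`S₂^{0}(0) ≤ 3`, part Ϻ-u), ★★★ `μ⁰_∞`-a.s. `|φ(z)| < 2√(S₂^{0}(0)Σ_νlog(2+|z_ν|))` for all but finitely many `z`.  NOT Bałaban's objects; NOT a node discharge; nothing continuum-Yang–Mills ∕ `ℝ⁴` ∕ OS ∕ Clay.
0 `sorry`, 0 def; standard axioms.

WHAT THIS FILE PROVES (kernel).  §1 ★ `integral_cexp_I_fieldSum0`, ★★ **`tendsto_charFun_mass_zero_kingFieldInf`**, `tendsto_integral_exp_fieldSum_mass_zero`.  §2 ★ `measureReal_fieldSum0_ge_le_exp`,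
★★ **`measureReal_fieldSum0_ge_le`**, ★ `measureReal_abs_fieldSum0_ge_le`, ★★ **`measureReal_abs_eval0_ge_le`**, `measureReal_abs_eval0_ge_le_six`.  §3 `measureReal_abs_eval0_ge_logWeight_le`,
★★★ **`ae_eventually_abs_eval0_lt`**.

HONEST SCOPE.  King's free massless block field at infinite volume, `d + 1 ≥ 3`.  N15 untouched; counts unmoved.  Locators (use): [King1986] Thm 2.1 (2.22)–(2.23) p.654.
-/

noncomputable section

open scoped BigOperators Topology ENNReal
open Filter MeasureTheory ProbabilityTheory Finset Complex

namespace Summit.QuantumFields.YangMills.BalabanUVNodes.N15KingModelRung.InfiniteVolume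

open Summit.QuantumFields.YangMills.BalabanUVNodes.N15KingModelRung.OptimalDecay
open Summit.QuantumFields.YangMills.BalabanUVNodes.N15KingModelRung.ProperTime

variable {d : ℕ} {J : Type*}

/-! ## §1 Characteristic functionals and the Lévy form of `μ_{∞,m} ⇒ μ⁰_∞` -/

/-- ★ `∫e^{iΣ_{j∈T}c_jφ(p_j)}dμ⁰_∞ = exp(−½Σ_{j,j′}c_jc_{j′}S₂^{0}(p_{j′} − p_j))` (`d ≥ 2`). [folklore] -/
theorem integral_cexp_I_fieldSum0 (hd : 2 ≤ d) (T : Finset J) (p : J → Fin (d + 1) → ℤ) (c : J → ℝ) :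
    ∫ ω, Complex.exp (((∑ j ∈ T, c j * ω (p j) : ℝ) : ℂ) * I) ∂kingFieldInf0 d
      = Complex.exp (-(((∑ j ∈ T, ∑ j' ∈ T, c j * c j' * kingS2Inf0 (p j' - p j)) / 2 : ℝ) : ℂ)) := by
  haveI := isProbabilityMeasure_kingFieldInf0 hd
  have hY := hasGaussianLaw_fieldSum0 hd T p c
  have hlaw := hY.map_eq_gaussianReal
  have hchar := charFun_gaussianReal (μ := ∫ ω, (∑ j ∈ T, c j * ω (p j)) ∂kingFieldInf0 d)
    (v := (Var[fun ω : (Fin (d + 1) → ℤ) → ℝ => ∑ j ∈ T, c j * ω (p j); kingFieldInf0 d]).toNNReal) 1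
  have hcf : charFun ((kingFieldInf0 d).map fun ω : (Fin (d + 1) → ℤ) → ℝ => ∑ j ∈ T, c j * ω (p j)) 1
      = ∫ ω, Complex.exp (((∑ j ∈ T, c j * ω (p j) : ℝ) : ℂ) * I) ∂kingFieldInf0 d := by
    rw [charFun_apply_real, integral_map hY.aemeasurable]
    · simp only [Complex.ofReal_one, one_mul]
    · exact (by fun_prop : Continuous fun x : ℝ => Complex.exp (((1 : ℝ) : ℂ) * (x : ℂ) * I)).aestronglyMeasurable
  rw [← hlaw, hcf] at hchar
  simp only [Complex.ofReal_one, one_mul, one_pow, mul_one] at hchar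
  rw [hchar, integral_fieldSum0 hd T p c, Real.coe_toNNReal _ (variance_nonneg _ _), variance_fieldSum0 hd T p c]
  congr 1
  push_cast
  ring

/-- ★★ **THE LÉVY FORM OF `μ_{∞,m} ⇒ μ⁰_∞`**: for every finite family of sites and real coefficients, `∫e^{iΣc_jφ(p_j)}dμ_{∞,m²} → ∫e^{iΣc_jφ(p_j)}dμ⁰_∞` as `m² ↓ 0` — every finite-dimensional
marginal of the massive block fields converges weakly to that of the massless one (`d ≥ 2`). [cite: King1986, Thm 2.1 (2.22)–(2.23) p.654] -/
theorem tendsto_charFun_mass_zero_kingFieldInf (hd : 2 ≤ d) (T : Finset J) (p : J → Fin (d + 1) → ℤ) (c : J → ℝ) :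
    Tendsto (fun m2 : ℝ => ∫ ω, Complex.exp (((∑ j ∈ T, c j * ω (p j) : ℝ) : ℂ) * I) ∂kingFieldInf m2) (𝓝[>] 0)
      (𝓝 (∫ ω, Complex.exp (((∑ j ∈ T, c j * ω (p j) : ℝ) : ℂ) * I) ∂kingFieldInf0 d)) := by
  have hev : (fun m2 : ℝ => Complex.exp (-(((∑ j ∈ T, ∑ j' ∈ T, c j * c j' * kingS2Inf m2 (p j' - p j)) / 2 : ℝ) : ℂ)))
      =ᶠ[𝓝[>] 0] fun m2 : ℝ => ∫ ω, Complex.exp (((∑ j ∈ T, c j * ω (p j) : ℝ) : ℂ) * I) ∂kingFieldInf m2 :=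
    eventually_nhdsWithin_of_forall fun m2 hm2 => (integral_cexp_I_fieldSum hm2 T p c).symm
  rw [integral_cexp_I_fieldSum0 hd T p c]
  refine Tendsto.congr' hev ?_
  have hV : Tendsto (fun m2 : ℝ => (∑ j ∈ T, ∑ j' ∈ T, c j * c j' * kingS2Inf m2 (p j' - p j)) / 2) (𝓝[>] 0)
      (𝓝 ((∑ j ∈ T, ∑ j' ∈ T, c j * c j' * kingS2Inf0 (p j' - p j)) / 2)) :=
    (tendsto_finsetSum _ fun j _ => tendsto_finsetSum _ fun j' _ => (tendsto_kingS2Inf_nhdsGT_zero hd _).const_mul _).div_const 2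
  exact (Complex.continuous_exp.tendsto _).comp ((Complex.continuous_ofReal.tendsto _).comp hV).neg

/-- The exponential moments converge too: `∫e^{Σc_jφ(p_j)}dμ_{∞,m²} → ∫e^{Σc_jφ(p_j)}dμ⁰_∞` as `m² ↓ 0`. [folklore] -/
theorem tendsto_integral_exp_fieldSum_mass_zero (hd : 2 ≤ d) (T : Finset J) (p : J → Fin (d + 1) → ℤ) (c : J → ℝ) :
    Tendsto (fun m2 : ℝ => ∫ ω, Real.exp (∑ j ∈ T, c j * ω (p j)) ∂kingFieldInf m2) (𝓝[>] 0) (𝓝 (∫ ω, Real.exp (∑ j ∈ T, c j * ω (p j)) ∂kingFieldInf0 d)) := by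
  have hev : (fun m2 : ℝ => Real.exp ((∑ j ∈ T, ∑ j' ∈ T, c j * c j' * kingS2Inf m2 (p j' - p j)) / 2))
      =ᶠ[𝓝[>] 0] fun m2 : ℝ => ∫ ω, Real.exp (∑ j ∈ T, c j * ω (p j)) ∂kingFieldInf m2 :=
    eventually_nhdsWithin_of_forall fun m2 hm2 => (integral_exp_fieldSum hm2 T p c).symm
  rw [integral_exp_fieldSum0 hd T p c]
  refine Tendsto.congr' hev ((Real.continuous_exp.tendsto _).comp ?_)
  exact (tendsto_finsetSum _ fun j _ => tendsto_finsetSum _ fun j' _ => (tendsto_kingS2Inf_nhdsGT_zero hd _).const_mul _).div_const 2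

/-! ## §2 Sub-Gaussian tails of the massless field -/

/-- ★ Chernoff with a free parameter under `μ⁰_∞`: `μ⁰_∞{a ≤ Σc_jφ(p_j)} ≤ exp(−ta + t²V⁰∕2)` (`t ≥ 0`). [folklore] -/
theorem measureReal_fieldSum0_ge_le_exp (hd : 2 ≤ d) (T : Finset J) (p : J → Fin (d + 1) → ℤ) (c : J → ℝ) (a : ℝ) {t : ℝ} (ht : 0 ≤ t) :
    (kingFieldInf0 d).real {ω | a ≤ ∑ j ∈ T, c j * ω (p j)}
      ≤ Real.exp (-t * a + t ^ 2 * (∑ j ∈ T, ∑ j' ∈ T, c j * c j' * kingS2Inf0 (p j' - p j)) / 2) := by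
  haveI := isProbabilityMeasure_kingFieldInf0 hd
  have hresc : ∀ ω : (Fin (d + 1) → ℤ) → ℝ, t * ∑ j ∈ T, c j * ω (p j) = ∑ j ∈ T, t * c j * ω (p j) := fun ω => by
    rw [Finset.mul_sum]
    exact Finset.sum_congr rfl fun j _ => by ring
  have key := integral_exp_fieldSum0 hd T p (fun j => t * c j)
  have keyI := integrable_exp_fieldSum0 hd T p (fun j => t * c j)
  beta_reduce at key keyI
  have hint : Integrable (fun ω : (Fin (d + 1) → ℤ) → ℝ => Real.exp (t * ∑ j ∈ T, c j * ω (p j))) (kingFieldInf0 d) := by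
    simp_rw [hresc]; exact keyI
  have h := measure_ge_le_exp_mul_mgf (μ := kingFieldInf0 d) (X := fun ω : (Fin (d + 1) → ℤ) → ℝ => ∑ j ∈ T, c j * ω (p j)) a ht hint
  have hmgf : mgf (fun ω : (Fin (d + 1) → ℤ) → ℝ => ∑ j ∈ T, c j * ω (p j)) (kingFieldInf0 d) t
      = Real.exp (t ^ 2 * (∑ j ∈ T, ∑ j' ∈ T, c j * c j' * kingS2Inf0 (p j' - p j)) / 2) := by
    simp only [mgf]
    simp_rw [hresc]
    rw [key]
    congr 2
    rw [Finset.mul_sum]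
    refine Finset.sum_congr rfl fun j _ => ?_
    rw [Finset.mul_sum]
    exact Finset.sum_congr rfl fun j' _ => by ring
  rw [hmgf, ← Real.exp_add] at h
  exact h

/-- ★★ **SUB-GAUSSIAN TAIL OF THE MASSLESS FIELD**: `μ⁰_∞{a ≤ Σc_jφ(p_j)} ≤ exp(−a²∕2V⁰)` (`a ≥ 0`). [folklore] -/
theorem measureReal_fieldSum0_ge_le (hd : 2 ≤ d) (T : Finset J) (p : J → Fin (d + 1) → ℤ) (c : J → ℝ) {a : ℝ} (ha : 0 ≤ a) :
    (kingFieldInf0 d).real {ω | a ≤ ∑ j ∈ T, c j * ω (p j)} ≤ Real.exp (-(a ^ 2 / (2 * ∑ j ∈ T, ∑ j' ∈ T, c j * c j' * kingS2Inf0 (p j' - p j)))) := by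
  have hV : 0 ≤ ∑ j ∈ T, ∑ j' ∈ T, c j * c j' * kingS2Inf0 (p j' - p j) := by
    rw [← variance_fieldSum0 hd T p c]; exact variance_nonneg _ _
  exact chernoff_optimize ha hV fun t ht => measureReal_fieldSum0_ge_le_exp hd T p c a ht

/-- ★ Two-sided: `μ⁰_∞{a ≤ |Σc_jφ(p_j)|} ≤ 2exp(−a²∕2V⁰)`. [folklore] -/
theorem measureReal_abs_fieldSum0_ge_le (hd : 2 ≤ d) (T : Finset J) (p : J → Fin (d + 1) → ℤ) (c : J → ℝ) {a : ℝ} (ha : 0 ≤ a) :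
    (kingFieldInf0 d).real {ω | a ≤ |∑ j ∈ T, c j * ω (p j)|} ≤ 2 * Real.exp (-(a ^ 2 / (2 * ∑ j ∈ T, ∑ j' ∈ T, c j * c j' * kingS2Inf0 (p j' - p j)))) := by
  haveI := isProbabilityMeasure_kingFieldInf0 hd
  have hneg : ∀ ω : (Fin (d + 1) → ℤ) → ℝ, ∑ j ∈ T, -c j * ω (p j) = -∑ j ∈ T, c j * ω (p j) := fun ω => by
    rw [← Finset.sum_neg_distrib]; exact Finset.sum_congr rfl fun j _ => by ring
  have hsub : {ω : (Fin (d + 1) → ℤ) → ℝ | a ≤ |∑ j ∈ T, c j * ω (p j)|}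
      ⊆ {ω | a ≤ ∑ j ∈ T, c j * ω (p j)} ∪ {ω | a ≤ ∑ j ∈ T, -c j * ω (p j)} := by
    intro ω hω
    simp only [Set.mem_setOf_eq, Set.mem_union] at hω ⊢
    rw [abs_eq_max_neg, le_max_iff] at hω
    rcases hω with h | h
    · exact Or.inl h
    · exact Or.inr (by rw [hneg]; exact h)
  have h1 := measureReal_fieldSum0_ge_le hd T p c ha
  have h2 := measureReal_fieldSum0_ge_le hd T p (fun j => -c j) ha
  have hV : ∑ j ∈ T, ∑ j' ∈ T, (fun j => -c j) j * (fun j => -c j) j' * kingS2Inf0 (p j' - p j) = ∑ j ∈ T, ∑ j' ∈ T, c j * c j' * kingS2Inf0 (p j' - p j) :=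
    Finset.sum_congr rfl fun j _ => Finset.sum_congr rfl fun j' _ => by ring
  rw [hV] at h2
  calc (kingFieldInf0 d).real {ω | a ≤ |∑ j ∈ T, c j * ω (p j)|}
      ≤ (kingFieldInf0 d).real ({ω | a ≤ ∑ j ∈ T, c j * ω (p j)} ∪ {ω | a ≤ ∑ j ∈ T, -c j * ω (p j)}) := measureReal_mono hsub
    _ ≤ (kingFieldInf0 d).real {ω | a ≤ ∑ j ∈ T, c j * ω (p j)} + (kingFieldInf0 d).real {ω | a ≤ ∑ j ∈ T, -c j * ω (p j)} := measureReal_union_le _ _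
    _ ≤ _ := by linarith

/-- ★★ **SINGLE-SITE TAIL OF THE MASSLESS FIELD**: `μ⁰_∞{a ≤ |φ(z)|} ≤ 2exp(−a²∕2S₂^{0}(0))`. [folklore] -/
theorem measureReal_abs_eval0_ge_le (hd : 2 ≤ d) (z : Fin (d + 1) → ℤ) {a : ℝ} (ha : 0 ≤ a) :
    (kingFieldInf0 d).real {ω | a ≤ |ω z|} ≤ 2 * Real.exp (-(a ^ 2 / (2 * kingS2Inf0 (0 : Fin (d + 1) → ℤ)))) := by
  have h := measureReal_abs_fieldSum0_ge_le hd (Finset.univ : Finset Unit) (fun _ => z) (fun _ => (1 : ℝ)) ha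
  simp only [Finset.univ_unique, Finset.sum_singleton, one_mul, sub_self] at h
  exact h

/-- `μ⁰_∞{a ≤ |φ(z)|} ≤ 2exp(−a²∕6)` (`S₂^{0}(0) ≤ 3`, part Ϻ-u). [folklore] -/
theorem measureReal_abs_eval0_ge_le_six (hd : 2 ≤ d) (z : Fin (d + 1) → ℤ) {a : ℝ} (ha : 0 ≤ a) :
    (kingFieldInf0 d).real {ω | a ≤ |ω z|} ≤ 2 * Real.exp (-(a ^ 2 / 6)) := by
  have hS0 := kingS2Inf0_pos hd (0 : Fin (d + 1) → ℤ)
  have hS3 := kingS2Inf0_le_three hd (0 : Fin (d + 1) → ℤ)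
  refine (measureReal_abs_eval0_ge_le hd z ha).trans (mul_le_mul_of_nonneg_left (Real.exp_le_exp.mpr (neg_le_neg ?_)) zero_le_two)
  exact div_le_div_of_nonneg_left (sq_nonneg a) (by positivity) (by linarith)

/-! ## §3 Almost-sure logarithmic growth of the massless field -/

/-- At the threshold `a_z = 2√(S₂^{0}(0)Σ_νlog(2+|z_ν|))`: `μ⁰_∞{a_z ≤ |φ(z)|} ≤ 2Π_ν(2+|z_ν|)^{−2}`. [folklore] -/
theorem measureReal_abs_eval0_ge_logWeight_le (hd : 2 ≤ d) (z : Fin (d + 1) → ℤ) :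
    (kingFieldInf0 d).real {ω | 2 * Real.sqrt (kingS2Inf0 (0 : Fin (d + 1) → ℤ) * ∑ ν, Real.log (2 + |(z ν : ℝ)|)) ≤ |ω z|} ≤ 2 * ∏ ν, ((2 + |(z ν : ℝ)|) ^ 2)⁻¹ := by
  have hσ : 0 < kingS2Inf0 (0 : Fin (d + 1) → ℤ) := kingS2Inf0_pos hd 0
  have hσne : kingS2Inf0 (0 : Fin (d + 1) → ℤ) ≠ 0 := hσ.ne'
  have hL : 0 ≤ ∑ ν, Real.log (2 + |(z ν : ℝ)|) := Finset.sum_nonneg fun ν _ => Real.log_nonneg (by linarith [abs_nonneg (z ν : ℝ)])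
  have h := measureReal_abs_eval0_ge_le hd z (a := 2 * Real.sqrt (kingS2Inf0 (0 : Fin (d + 1) → ℤ) * ∑ ν, Real.log (2 + |(z ν : ℝ)|))) (by positivity)
  have hexp : Real.exp (-((2 * Real.sqrt (kingS2Inf0 (0 : Fin (d + 1) → ℤ) * ∑ ν, Real.log (2 + |(z ν : ℝ)|))) ^ 2 / (2 * kingS2Inf0 (0 : Fin (d + 1) → ℤ))))
      = ∏ ν, ((2 + |(z ν : ℝ)|) ^ 2)⁻¹ := by
    rw [mul_pow, Real.sq_sqrt (mul_nonneg hσ.le hL),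
      show -((2 : ℝ) ^ 2 * (kingS2Inf0 (0 : Fin (d + 1) → ℤ) * ∑ ν, Real.log (2 + |(z ν : ℝ)|)) / (2 * kingS2Inf0 (0 : Fin (d + 1) → ℤ)))
          = ∑ ν, -(2 * Real.log (2 + |(z ν : ℝ)|)) by
        rw [Finset.sum_neg_distrib, ← Finset.mul_sum]; field_simp,
      Real.exp_sum]
    refine Finset.prod_congr rfl fun ν _ => ?_
    have h2 : 0 < 2 + |(z ν : ℝ)| := by positivity
    rw [Real.exp_neg, two_mul, Real.exp_add, Real.exp_log h2, sq]
  rw [hexp] at h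
  exact h

/-- ★★★ **ALMOST-SURE LOGARITHMIC GROWTH OF THE MASSLESS BLOCK FIELD**: `μ⁰_∞`-a.s., `|φ(z)| < 2√(S₂^{0}(0)Σ_νlog(2+|z_ν|))` for all but finitely many `z ∈ ℤ^{d+1}` (`d ≥ 2`; first
Borel–Cantelli lemma, part Ϻ-w's summable weights). [folklore] -/
theorem ae_eventually_abs_eval0_lt (hd : 2 ≤ d) :
    ∀ᵐ ω ∂kingFieldInf0 d, ∀ᶠ z : Fin (d + 1) → ℤ in cofinite, |ω z| < 2 * Real.sqrt (kingS2Inf0 (0 : Fin (d + 1) → ℤ) * ∑ ν, Real.log (2 + |(z ν : ℝ)|)) := by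
  haveI := isProbabilityMeasure_kingFieldInf0 hd
  have hw0 : ∀ z : Fin (d + 1) → ℤ, 0 ≤ 2 * ∏ ν, ((2 + |(z ν : ℝ)|) ^ 2)⁻¹ := fun z => by positivity
  have hws : Summable fun z : Fin (d + 1) → ℤ => 2 * ∏ ν, ((2 + |(z ν : ℝ)|) ^ 2)⁻¹ :=
    (summable_pi_prod (g := fun k : ℤ => ((2 + |(k : ℝ)|) ^ 2)⁻¹) (fun k => by positivity) summable_inv_two_add_abs_sq).mul_left 2
  have hsum : ∑' z : Fin (d + 1) → ℤ, kingFieldInf0 d {ω | 2 * Real.sqrt (kingS2Inf0 (0 : Fin (d + 1) → ℤ) * ∑ ν, Real.log (2 + |(z ν : ℝ)|)) ≤ |ω z|} ≠ ∞ := by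
    refine ne_top_of_le_ne_top (b := ENNReal.ofReal (∑' z : Fin (d + 1) → ℤ, 2 * ∏ ν, ((2 + |(z ν : ℝ)|) ^ 2)⁻¹)) ENNReal.ofReal_ne_top ?_
    calc ∑' z : Fin (d + 1) → ℤ, kingFieldInf0 d {ω | 2 * Real.sqrt (kingS2Inf0 (0 : Fin (d + 1) → ℤ) * ∑ ν, Real.log (2 + |(z ν : ℝ)|)) ≤ |ω z|}
        ≤ ∑' z : Fin (d + 1) → ℤ, ENNReal.ofReal (2 * ∏ ν, ((2 + |(z ν : ℝ)|) ^ 2)⁻¹) := ENNReal.tsum_le_tsum fun z => by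
          rw [← ofReal_measureReal (measure_ne_top _ _)]
          exact ENNReal.ofReal_le_ofReal (measureReal_abs_eval0_ge_logWeight_le hd z)
      _ = ENNReal.ofReal (∑' z : Fin (d + 1) → ℤ, 2 * ∏ ν, ((2 + |(z ν : ℝ)|) ^ 2)⁻¹) := (ENNReal.ofReal_tsum_of_nonneg hw0 hws).symm
  filter_upwards [ae_finite_setOf_mem (μ := kingFieldInf0 d) hsum] with ω hω
  rw [Filter.eventually_cofinite]
  refine hω.subset fun z hz => ?_
  simp only [Set.mem_setOf_eq, not_lt] at hz ⊢
  exact hz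

end Summit.QuantumFields.YangMills.BalabanUVNodes.N15KingModelRung.InfiniteVolume
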